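import Summits.CriticalPhenomena.PercolationContinuityZ3.Theorems.Transplant.BccSlabStackedKit
import HarnessLib

/-!
# The bcc (001)-slabs, exit-form routing certificate IX: the STACKED TEMPLATE, height difference two (`E₂` two layers above `E₁`)

builds on p205010 (kernel theorem, internal audit signed; external expert review pending) — NOT used in this file.
Lane `prim-bschramm`, seat `prim-bschramm-p2` (gen 46; class C1b, METHOD = input substitution; memo `HOME/bschramm/P2-LATTICES.md` §156); helper file
(`--supports stmt-CriticalPhenomena-4575 --as helper`).
In a frame `(A; μ, ν)` («BccClawXStack»; columns `a = (0,0)`, `s = (1,0)`, `u = (0,1)`, `d = (1,1)`, `u' = (0,2)`, `d' = (1,2)`), terminals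
`E₁ = (a, h₁)`, `E₂ = (a, h₁ + 2)` and exit `w' = (s, h')`: an explicit SWAP PAIR of routings (design validated exhaustively for `k ≤ 9` outside Lean):
* §0 disjointness tools for explicit frame paths and monotone connectors;
* §1 `h' ≠ h₁ + 1`: `c = E₁`, `y = (u, h₁+1)`, `b = (s, h₁+1)`; chains `E₁ y E₂` / `E₁ b E₂`; branches monotone in `{s, d}`;
* §2 `h' = h₁ + 1`, `h₁ + 3 ≤ k`: `c = (u, h₁+1)`, `y = (d, h₁+2)`, `b = (d, h₁)`; chains `E₁ c y (u,h₁+3) E₂` / `E₁ c b (d',h₁+1) (u',h₁+2) (u,h₁+3) E₂`;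
* §3 `h' = h₁ + 1`, `h₁ + 2 = k`: `c = E₁`, `y = (u, h₁−1)`, `b = (s, h₁−1)`; chains `E₁ y (u',h₁) (u,h₁+1) E₂` / `E₁ b (d,h₁) (u,h₁+1) E₂`;
* §4 **`Frame.stacked_swapPair_two`** (`k ≥ 3`).
[cite: DuminilCopinSidoraviciusTassion2016, §2.3 (proof of Fact 2: the three disjoint paths)]
-/

noncomputable section

namespace Summit.CriticalPhenomena.PercolationContinuityZ3.Theorems.Transplant

namespace BccClawX

namespace Frame

open Literature.Probability.Percolation Literature.Probability.LatticeModels SimpleGraph BccSlab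
open scoped Classical

variable {k : ℕ} {RP : Set (Site 2)} {A : Site 2} {μ ν : Pt} (F : Frame RP A μ ν)
include F

/-! ## §0 Tools -/

omit F in
/-- `Step` on explicit triples. [folklore] -/
theorem step_iff (i j h i' j' h' : ℤ) :
    Step (i, j, h) (i', j', h') ↔ ((i' = i ∧ (j' = j + 1 ∨ j = j' + 1)) ∨ (j' = j ∧ (i' = i + 1 ∨ i = i' + 1))) ∧ (h' = h + 1 ∨ h' = h - 1) :=
  Iff.rfl

omit F in
/-- A `Step` from its arithmetic description (arguments by unification). [folklore] -/
theorem stp {i j h i' j' h' : ℤ}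
    (hh : ((i' = i ∧ (j' = j + 1 ∨ j = j' + 1)) ∨ (j' = j ∧ (i' = i + 1 ∨ i = i' + 1))) ∧ (h' = h + 1 ∨ h' = h - 1)) :
    Step (i, j, h) (i', j', h') := hh

/-- Admissibility of a frame vertex from an explicit parity witness. [folklore] -/
theorem adm' {h₁ : ℤ} (hA : Adm k A h₁) (i j h m : ℤ) (hm : i + j + (h - h₁) = 2 * m) (h0 : 0 ≤ h) (hk : h ≤ k) : Adm k (fcol A μ ν i j) h :=
  F.adm hA ⟨m, by rw [hm]; ring⟩ h0 hk

/-- Two explicit frame paths with no common triple are vertex-disjoint. [folklore] -/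
theorem fpath_disjoint {ts ts' : List (ℤ × ℤ × ℤ)} (hadm : ∀ t ∈ ts, Adm k (fcol A μ ν t.1 t.2.1) t.2.2) (hadm' : ∀ t ∈ ts', Adm k (fcol A μ ν t.1 t.2.1) t.2.2)
    (hdis : ∀ t ∈ ts, t ∉ ts') : ∀ x ∈ fpath k A μ ν ts, x ∉ fpath k A μ ν ts' := by
  intro x hx hx'
  obtain ⟨t, ht, rfl⟩ := mem_fpath.1 hx
  obtain ⟨t', ht', he⟩ := mem_fpath.1 hx'
  obtain ⟨e1, e2, e3⟩ := F.fv_inj (hadm t ht) (hadm' t' ht') he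
  exact hdis t ht (by rwa [show t = t' from Prod.ext e1 (Prod.ext e2 e3)])

/-- A vertex list with column/height control misses an explicit frame path whose triples over those columns avoid the height range. [folklore] -/
theorem ctrl_disjoint {L : List (bslab k)} {i j i' j' lo hi : ℤ} (hL : ∀ x ∈ L, (sh x = fcol A μ ν i j ∨ sh x = fcol A μ ν i' j') ∧ lo ≤ ht x ∧ ht x ≤ hi)
    {ts : List (ℤ × ℤ × ℤ)} (hadm : ∀ t ∈ ts, Adm k (fcol A μ ν t.1 t.2.1) t.2.2)
    (hav : ∀ t ∈ ts, ((t.1 = i ∧ t.2.1 = j) ∨ (t.1 = i' ∧ t.2.1 = j')) → ¬ (lo ≤ t.2.2 ∧ t.2.2 ≤ hi)) : ∀ x ∈ L, x ∉ fpath k A μ ν ts := by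
  intro x hx hx'
  obtain ⟨hcol, hlo, hhi⟩ := hL x hx
  obtain ⟨t, ht, hsh, hht⟩ := sh_ht_of_mem_fpath hadm hx'
  refine hav t ht ?_ ⟨hht ▸ hlo, hht ▸ hhi⟩
  rcases hcol with h | h <;> rw [hsh] at h
  · obtain ⟨e1, e2⟩ := fcol_inj F.hμ F.hν F.hperp h; exact Or.inl ⟨e1, e2⟩
  · obtain ⟨e1, e2⟩ := fcol_inj F.hμ F.hν F.hperp h; exact Or.inr ⟨e1, e2⟩

/-- Vertices with column/height control lie in `W` when the two columns are patch columns. [folklore] -/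
theorem ctrl_mem {W : Set (bslab k)} (hW : ∀ x : bslab k, sh x ∈ RP → x ∈ W) {L : List (bslab k)} {i j i' j' lo hi : ℤ}
    (hL : ∀ x ∈ L, (sh x = fcol A μ ν i j ∨ sh x = fcol A μ ν i' j') ∧ lo ≤ ht x ∧ ht x ≤ hi)
    (hij : 0 ≤ i ∧ i ≤ 1 ∧ 0 ≤ j ∧ j ≤ 2) (hij' : 0 ≤ i' ∧ i' ≤ 1 ∧ 0 ≤ j' ∧ j' ≤ 2) : ∀ x ∈ L, x ∈ W := by
  intro x hx
  apply hW
  rcases (hL x hx).1 with h | h <;> rw [h]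
  · exact F.hreg i j hij.1 hij.2.1 hij.2.2.1 hij.2.2.2
  · exact F.hreg i' j' hij'.1 hij'.2.1 hij'.2.2.1 hij'.2.2.2

/-- Vertices of an explicit frame path over patch columns lie in `W`. [folklore] -/
theorem fpath_mem {W : Set (bslab k)} (hW : ∀ x : bslab k, sh x ∈ RP → x ∈ W) {ts : List (ℤ × ℤ × ℤ)}
    (hadm : ∀ t ∈ ts, Adm k (fcol A μ ν t.1 t.2.1) t.2.2) (hpatch : ∀ t ∈ ts, 0 ≤ t.1 ∧ t.1 ≤ 1 ∧ 0 ≤ t.2.1 ∧ t.2.1 ≤ 2) :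
    ∀ x ∈ fpath k A μ ν ts, x ∈ W := by
  intro x hx
  obtain ⟨t, ht, hsh, -⟩ := sh_ht_of_mem_fpath hadm hx
  apply hW; rw [hsh]
  obtain ⟨a, b, c, d⟩ := hpatch t ht
  exact F.hreg _ _ a b c d

/-! ## §1 `h' ≠ h₁ + 1` -/

/-- **The stacked template, `Δ = 2`, exit height `h' ≠ h₁ + 1`.** [cite: DuminilCopinSidoraviciusTassion2016, §2.3 (proof of Fact 2)] -/
theorem stacked_two_B1 {WR W : Set (bslab k)} (hWR : ∀ x : bslab k, sh x ∈ RP → x ∈ WR) (hWRW : WR ⊆ W) {h₁ h' : ℤ}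
    (hA : Adm k A h₁) (hA2 : h₁ + 2 ≤ k) (hS : Adm k (fcol A μ ν 1 0) h') (hne : h' ≠ h₁ + 1) :
    ∃ r₁ r₂ : VRouteData (slabGraph k) WR W (fv k A μ ν 0 0 h₁) (fv k A μ ν 0 0 (h₁ + 2)) (fv k A μ ν 1 0 h'), r₁.y = r₂.b ∧ r₁.b = r₂.y := by
  have hW : ∀ x : bslab k, sh x ∈ RP → x ∈ W := fun x hx => hWRW (hWR x hx)
  have h0 := hA.1
  -- parity of h'
  have hpar' : Even (1 + 0 + (h' - h₁)) := by
    obtain ⟨m, hm⟩ := hA.2.2; obtain ⟨m', hm'⟩ := hS.2.2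
    rw [fcol_sum] at hm'
    rcases unit_sum F.hμ with e | e <;> rw [e] at hm'
    · exact ⟨m - m' + 1, by omega⟩
    · exact ⟨m - m', by omega⟩
  obtain ⟨m', hm'⟩ := hpar'
  -- admissible vertices
  have aE₁ : Adm k (fcol A μ ν 0 0) h₁ := F.adm' hA 0 0 h₁ 0 (by ring) h0 (by omega)
  have aE₂ : Adm k (fcol A μ ν 0 0) (h₁ + 2) := F.adm' hA 0 0 (h₁ + 2) 1 (by ring) (by omega) hA2
  have ay : Adm k (fcol A μ ν 0 1) (h₁ + 1) := F.adm' hA 0 1 (h₁ + 1) 1 (by ring) (by omega) (by omega)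
  have ab : Adm k (fcol A μ ν 1 0) (h₁ + 1) := F.adm' hA 1 0 (h₁ + 1) 1 (by ring) (by omega) (by omega)
  have hE : fv k A μ ν 0 0 h₁ ≠ fv k A μ ν 0 0 (h₁ + 2) := fun e => by have := (F.fv_inj aE₁ aE₂ e).2.2; omega
  -- chain₁ = E₁, y, E₂ ; chain₂ = E₁, b, E₂
  have admL : ∀ (p : ℤ × ℤ × ℤ), (p = ((0 : ℤ), (0 : ℤ), h₁) ∨ p = (0, 1, h₁ + 1) ∨ p = (1, 0, h₁ + 1) ∨ p = (0, 0, h₁ + 2)) →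
      Adm k (fcol A μ ν p.1 p.2.1) p.2.2 := by
    rintro p (rfl | rfl | rfl | rfl)
    exacts [aE₁, ay, ab, aE₂]
  have hadm₁ : ∀ t ∈ [((0 : ℤ), (0 : ℤ), h₁), (0, 1, h₁ + 1), (0, 0, h₁ + 2)], Adm k (fcol A μ ν t.1 t.2.1) t.2.2 := by
    intro t ht; simp only [List.mem_cons, List.not_mem_nil, or_false] at ht
    rcases ht with rfl | rfl | rfl <;> apply admL <;> simp
  have hadm₂ : ∀ t ∈ [((0 : ℤ), (0 : ℤ), h₁), (1, 0, h₁ + 1), (0, 0, h₁ + 2)], Adm k (fcol A μ ν t.1 t.2.1) t.2.2 := by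
    intro t ht; simp only [List.mem_cons, List.not_mem_nil, or_false] at ht
    rcases ht with rfl | rfl | rfl <;> apply admL <;> simp
  have hG₁ := F.gpath_fpath (ts := [((0 : ℤ), (0 : ℤ), h₁), (0, 1, h₁ + 1), (0, 0, h₁ + 2)]) (by simp) hadm₁
    (by simp only [List.nodup_cons, List.mem_cons, List.not_mem_nil, Prod.mk.injEq, not_or, List.nodup_nil, and_true,
      or_false, not_false_eq_true]; omega)
    (List.IsChain.cons_cons (stp (by omega)) (List.IsChain.cons_cons (stp (by omega)) (List.IsChain.singleton _)))
  have hG₂ := F.gpath_fpath (ts := [((0 : ℤ), (0 : ℤ), h₁), (1, 0, h₁ + 1), (0, 0, h₁ + 2)]) (by simp) hadm₂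
    (by simp only [List.nodup_cons, List.mem_cons, List.not_mem_nil, Prod.mk.injEq, not_or, List.nodup_nil, and_true,
      or_false, not_false_eq_true]; omega)
    (List.IsChain.cons_cons (stp (by omega)) (List.IsChain.cons_cons (stp (by omega)) (List.IsChain.singleton _)))
  simp only [List.head_cons, List.getLast_cons_cons, List.getLast_singleton] at hG₁ hG₂
  -- branch 1: monotone in {s, d} from b to w'
  obtain ⟨L₁, hL₁G, hL₁⟩ := F.exists_mono (i := 1) (j := 0) (i' := 1) (j' := 1) (Or.inl ⟨rfl, Or.inl rfl⟩) ab (p := 1) (q := 0) (Or.inl ⟨rfl, rfl⟩) hS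
  -- branch 2: y then monotone in {d, s} from (d, t₀) to w'
  set t₀ : ℤ := if h₁ + 1 < h' then h₁ + 2 else h₁ with ht₀
  have ht₀' : (h₁ + 1 < h' ∧ t₀ = h₁ + 2) ∨ (h' < h₁ + 1 ∧ t₀ = h₁) := by
    rw [ht₀]; split_ifs with hlt
    · exact Or.inl ⟨hlt, rfl⟩
    · exact Or.inr ⟨by omega, rfl⟩
  have ad : Adm k (fcol A μ ν 1 1) t₀ := by
    rcases ht₀' with ⟨hlt, e⟩ | ⟨hlt, e⟩ <;> rw [e]
    · exact F.adm' hA 1 1 (h₁ + 2) 2 (by ring) (by omega) (by have := hS.2.1; omega)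
    · exact F.adm' hA 1 1 h₁ 1 (by ring) h0 (by omega)
  obtain ⟨L₂, hL₂G, hL₂⟩ := F.exists_mono (i := 1) (j := 1) (i' := 1) (j' := 0) (Or.inl ⟨rfl, Or.inr rfl⟩) ad (p := 1) (q := 0) (Or.inr ⟨rfl, rfl⟩) hS
  have hyL₂ : fv k A μ ν 0 1 (h₁ + 1) ∉ L₂ := by
    intro h
    rcases (hL₂ _ h).1 with e | e <;> rw [sh_fv ay] at e <;> have := fcol_inj F.hμ F.hν F.hperp e <;> omega
  have hBr₂ : GPath (slabGraph k) (fv k A μ ν 0 1 (h₁ + 1) :: L₂) (fv k A μ ν 0 1 (h₁ + 1)) (fv k A μ ν 1 0 h') :=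
    hL₂G.cons (F.fv_adj ay ad (Or.inr ⟨rfl, Or.inl rfl⟩) (by
      rcases ht₀' with ⟨-, e⟩ | ⟨-, e⟩
      · rw [e]; left; ring
      · rw [e]; right; ring)) hyL₂
  -- routing 1
  obtain ⟨r₁, h1y, h1b⟩ := VRouteData.exists_ofPaths' (WR := WR) (W := W) hG₁ hE
    (F.fpath_mem hWR hadm₁ (by intro t ht; simp only [List.mem_cons, List.not_mem_nil, or_false] at ht; rcases ht with rfl | rfl | rfl <;> simp))
    ⟨[], [fv k A μ ν 0 0 (h₁ + 2)], rfl⟩ hL₁G (F.ctrl_mem hW hL₁ (by omega) (by omega))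
    (F.fv_adj aE₁ ab (Or.inr ⟨rfl, Or.inl rfl⟩) (Or.inl rfl))
    (F.ctrl_disjoint hL₁ hadm₁ (by
      intro t ht; simp only [List.mem_cons, List.not_mem_nil, or_false] at ht
      rcases ht with rfl | rfl | rfl <;> simp))
  -- routing 2
  obtain ⟨r₂, h2y, h2b⟩ := VRouteData.exists_ofPaths' (WR := WR) (W := W) hG₂ hE
    (F.fpath_mem hWR hadm₂ (by intro t ht; simp only [List.mem_cons, List.not_mem_nil, or_false] at ht; rcases ht with rfl | rfl | rfl <;> simp))
    ⟨[], [fv k A μ ν 0 0 (h₁ + 2)], rfl⟩ hBr₂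
    (by
      intro x hx
      rcases List.mem_cons.1 hx with rfl | hx
      · exact hW _ (by rw [sh_fv ay]; exact F.hreg 0 1 le_rfl (by norm_num) (by norm_num) (by norm_num))
      · exact F.ctrl_mem hW hL₂ (by omega) (by omega) x hx)
    (F.fv_adj aE₁ ay (Or.inl ⟨rfl, Or.inl rfl⟩) (Or.inl rfl))
    (by
      intro x hx
      rcases List.mem_cons.1 hx with rfl | hx
      · refine F.fpath_disjoint (ts := [((0 : ℤ), (1 : ℤ), h₁ + 1)]) (by intro t ht; simp at ht; rw [ht]; exact ay) hadm₂ ?_ _ (by simp [fpath])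
        intro t ht; simp only [List.mem_singleton] at ht; subst ht; simp
      · refine F.ctrl_disjoint hL₂ hadm₂ ?_ x hx
        intro t ht; simp only [List.mem_cons, List.not_mem_nil, or_false] at ht
        rcases ht₀' with ⟨hlt, e⟩ | ⟨hlt, e⟩ <;> rw [e] <;> rcases ht with rfl | rfl | rfl <;> simp <;> omega)
  refine ⟨r₁, r₂, ?_, ?_⟩
  · rw [h1y, h2b]
  · rw [h1b, h2y]

/-! ## §2 `h' = h₁ + 1`, room above (`h₁ + 3 ≤ k`) -/

/-- **The stacked template, `Δ = 2`, exit height `h' = h₁ + 1`, `h₁ + 3 ≤ k`.** [cite: DuminilCopinSidoraviciusTassion2016, §2.3 (proof of Fact 2)] -/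
theorem stacked_two_B2b {WR W : Set (bslab k)} (hWR : ∀ x : bslab k, sh x ∈ RP → x ∈ WR) (hWRW : WR ⊆ W) {h₁ : ℤ}
    (hA : Adm k A h₁) (hA3 : h₁ + 3 ≤ k) :
    ∃ r₁ r₂ : VRouteData (slabGraph k) WR W (fv k A μ ν 0 0 h₁) (fv k A μ ν 0 0 (h₁ + 2)) (fv k A μ ν 1 0 (h₁ + 1)),
      r₁.y = r₂.b ∧ r₁.b = r₂.y := by
  have hW : ∀ x : bslab k, sh x ∈ RP → x ∈ W := fun x hx => hWRW (hWR x hx)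
  have h0 := hA.1
  have hk1 := hA.2.1
  -- admissibility of every triple used
  have adm8 : ∀ (p : ℤ × ℤ × ℤ), p ∈ [((0 : ℤ), (0 : ℤ), h₁), (0, 1, h₁ + 1), (1, 1, h₁ + 2), (0, 1, h₁ + 3), (0, 0, h₁ + 2), (1, 1, h₁), (1, 0, h₁ + 1),
      (1, 2, h₁ + 1), (0, 2, h₁ + 2)] → Adm k (fcol A μ ν p.1 p.2.1) p.2.2 := by
    intro p hp
    simp only [List.mem_cons, List.not_mem_nil, or_false] at hp
    rcases hp with rfl | rfl | rfl | rfl | rfl | rfl | rfl | rfl | rfl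
    · exact F.adm' hA 0 0 h₁ 0 (by ring) h0 (by omega)
    · exact F.adm' hA 0 1 (h₁ + 1) 1 (by ring) (by omega) (by omega)
    · exact F.adm' hA 1 1 (h₁ + 2) 2 (by ring) (by omega) (by omega)
    · exact F.adm' hA 0 1 (h₁ + 3) 2 (by ring) (by omega) hA3
    · exact F.adm' hA 0 0 (h₁ + 2) 1 (by ring) (by omega) (by omega)
    · exact F.adm' hA 1 1 h₁ 1 (by ring) h0 (by omega)
    · exact F.adm' hA 1 0 (h₁ + 1) 1 (by ring) (by omega) (by omega)
    · exact F.adm' hA 1 2 (h₁ + 1) 2 (by ring) (by omega) (by omega)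
    · exact F.adm' hA 0 2 (h₁ + 2) 2 (by ring) (by omega) (by omega)
  have sub : ∀ (ts : List (ℤ × ℤ × ℤ)), (∀ t ∈ ts, t ∈ [((0 : ℤ), (0 : ℤ), h₁), (0, 1, h₁ + 1), (1, 1, h₁ + 2), (0, 1, h₁ + 3), (0, 0, h₁ + 2), (1, 1, h₁),
      (1, 0, h₁ + 1), (1, 2, h₁ + 1), (0, 2, h₁ + 2)]) → ∀ t ∈ ts, Adm k (fcol A μ ν t.1 t.2.1) t.2.2 := fun ts h t ht => adm8 t (h t ht)
  have hadm₁ := sub [((0 : ℤ), (0 : ℤ), h₁), (0, 1, h₁ + 1), (1, 1, h₁ + 2), (0, 1, h₁ + 3), (0, 0, h₁ + 2)] (by intro t ht; simp at ht ⊢; tauto)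
  have hadm₂ := sub [((0 : ℤ), (0 : ℤ), h₁), (0, 1, h₁ + 1), (1, 1, h₁), (1, 2, h₁ + 1), (0, 2, h₁ + 2), (0, 1, h₁ + 3), (0, 0, h₁ + 2)]
    (by intro t ht; simp at ht ⊢; tauto)
  have hadmB₁ := sub [((1 : ℤ), (1 : ℤ), h₁), (1, 0, h₁ + 1)] (by intro t ht; simp at ht ⊢; tauto)
  have hadmB₂ := sub [((1 : ℤ), (1 : ℤ), h₁ + 2), (1, 0, h₁ + 1)] (by intro t ht; simp at ht ⊢; tauto)
  have hE : fv k A μ ν 0 0 h₁ ≠ fv k A μ ν 0 0 (h₁ + 2) := fun e => by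
    have := (F.fv_inj (i := 0) (j := 0) (h := h₁) (i' := 0) (j' := 0) (h' := h₁ + 2) (adm8 (0, 0, h₁) (by simp)) (adm8 (0, 0, h₁ + 2) (by simp)) e).2.2
    omega
  have hG₁ := F.gpath_fpath (ts := [((0 : ℤ), (0 : ℤ), h₁), (0, 1, h₁ + 1), (1, 1, h₁ + 2), (0, 1, h₁ + 3), (0, 0, h₁ + 2)]) (by simp) hadm₁
    (by simp only [List.nodup_cons, List.mem_cons, List.not_mem_nil, Prod.mk.injEq, not_or, List.nodup_nil, and_true, or_false,
      not_false_eq_true]; omega)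
    (List.IsChain.cons_cons (stp (by omega)) (List.IsChain.cons_cons (stp (by omega)) (List.IsChain.cons_cons (stp (by omega)) (List.IsChain.cons_cons (stp (by omega)) (List.IsChain.singleton _)))))
  have hG₂ := F.gpath_fpath (ts := [((0 : ℤ), (0 : ℤ), h₁), (0, 1, h₁ + 1), (1, 1, h₁), (1, 2, h₁ + 1), (0, 2, h₁ + 2), (0, 1, h₁ + 3), (0, 0, h₁ + 2)])
    (by simp) hadm₂
    (by simp only [List.nodup_cons, List.mem_cons, List.not_mem_nil, Prod.mk.injEq, not_or, List.nodup_nil, and_true, or_false,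
      not_false_eq_true]; omega)
    (List.IsChain.cons_cons (stp (by omega)) (List.IsChain.cons_cons (stp (by omega)) (List.IsChain.cons_cons (stp (by omega)) (List.IsChain.cons_cons (stp (by omega)) (List.IsChain.cons_cons (stp (by omega)) (List.IsChain.cons_cons (stp (by omega)) (List.IsChain.singleton _)))))))
  have hB₁ := F.gpath_fpath (ts := [((1 : ℤ), (1 : ℤ), h₁), (1, 0, h₁ + 1)]) (by simp) hadmB₁
    (by simp only [List.nodup_cons, List.mem_cons, List.not_mem_nil, Prod.mk.injEq, List.nodup_nil, and_true, or_false,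
      not_false_eq_true]; omega)
    (List.IsChain.cons_cons (stp (by omega)) (List.IsChain.singleton _))
  have hB₂ := F.gpath_fpath (ts := [((1 : ℤ), (1 : ℤ), h₁ + 2), (1, 0, h₁ + 1)]) (by simp) hadmB₂
    (by simp only [List.nodup_cons, List.mem_cons, List.not_mem_nil, Prod.mk.injEq, List.nodup_nil, and_true, or_false,
      not_false_eq_true]; omega)
    (List.IsChain.cons_cons (stp (by omega)) (List.IsChain.singleton _))
  simp only [List.head_cons, List.getLast_cons_cons, List.getLast_singleton] at hG₁ hG₂ hB₁ hB₂
  have patch : ∀ (ts : List (ℤ × ℤ × ℤ)), (∀ t ∈ ts, t ∈ [((0 : ℤ), (0 : ℤ), h₁), (0, 1, h₁ + 1), (1, 1, h₁ + 2), (0, 1, h₁ + 3), (0, 0, h₁ + 2),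
      (1, 1, h₁), (1, 0, h₁ + 1), (1, 2, h₁ + 1), (0, 2, h₁ + 2)]) → ∀ t ∈ ts, 0 ≤ t.1 ∧ t.1 ≤ 1 ∧ 0 ≤ t.2.1 ∧ t.2.1 ≤ 2 := by
    intro ts h t ht
    have := h t ht
    simp only [List.mem_cons, List.not_mem_nil, or_false] at this
    rcases this with rfl | rfl | rfl | rfl | rfl | rfl | rfl | rfl | rfl <;> norm_num
  obtain ⟨r₁, h1y, h1b⟩ := VRouteData.exists_ofPaths' (WR := WR) (W := W) (c := fv k A μ ν 0 1 (h₁ + 1)) (y := fv k A μ ν 1 1 (h₁ + 2)) hG₁ hE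
    (F.fpath_mem hWR hadm₁ (patch _ (by intro t ht; simp at ht ⊢; tauto)))
    ⟨[fv k A μ ν 0 0 h₁], [fv k A μ ν 0 1 (h₁ + 3), fv k A μ ν 0 0 (h₁ + 2)], rfl⟩ hB₁
    (F.fpath_mem hW hadmB₁ (patch _ (by intro t ht; simp at ht ⊢; tauto)))
    (F.fv_adj (adm8 (0, 1, h₁ + 1) (by simp)) (adm8 (1, 1, h₁) (by simp)) (Or.inr ⟨rfl, Or.inl rfl⟩) (Or.inr (by ring)))
    (F.fpath_disjoint hadmB₁ hadm₁ (by
      intro t ht; simp only [List.mem_cons, List.not_mem_nil, or_false] at ht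
      rcases ht with rfl | rfl <;> simp))
  obtain ⟨r₂, h2y, h2b⟩ := VRouteData.exists_ofPaths' (WR := WR) (W := W) (c := fv k A μ ν 0 1 (h₁ + 1)) (y := fv k A μ ν 1 1 h₁) hG₂ hE
    (F.fpath_mem hWR hadm₂ (patch _ (by intro t ht; simp at ht ⊢; tauto)))
    ⟨[fv k A μ ν 0 0 h₁], [fv k A μ ν 1 2 (h₁ + 1), fv k A μ ν 0 2 (h₁ + 2), fv k A μ ν 0 1 (h₁ + 3), fv k A μ ν 0 0 (h₁ + 2)], rfl⟩ hB₂
    (F.fpath_mem hW hadmB₂ (patch _ (by intro t ht; simp at ht ⊢; tauto)))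
    (F.fv_adj (adm8 (0, 1, h₁ + 1) (by simp)) (adm8 (1, 1, h₁ + 2) (by simp)) (Or.inr ⟨rfl, Or.inl rfl⟩) (Or.inl (by ring)))
    (F.fpath_disjoint hadmB₂ hadm₂ (by
      intro t ht; simp only [List.mem_cons, List.not_mem_nil, or_false] at ht
      rcases ht with rfl | rfl <;> simp))
  refine ⟨r₁, r₂, ?_, ?_⟩
  · rw [h1y, h2b]
  · rw [h1b, h2y]

/-! ## §3 `h' = h₁ + 1`, top (`h₁ + 2 = k`) -/

/-- **The stacked template, `Δ = 2`, exit height `h' = h₁ + 1`, `E₂` on the top layer** (`1 ≤ h₁`). [cite: DuminilCopinSidoraviciusTassion2016, §2.3 (proof of Fact 2)] -/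
theorem stacked_two_B2c {WR W : Set (bslab k)} (hWR : ∀ x : bslab k, sh x ∈ RP → x ∈ WR) (hWRW : WR ⊆ W) {h₁ : ℤ}
    (hA : Adm k A h₁) (h1 : 1 ≤ h₁) (hA2 : h₁ + 2 ≤ k) :
    ∃ r₁ r₂ : VRouteData (slabGraph k) WR W (fv k A μ ν 0 0 h₁) (fv k A μ ν 0 0 (h₁ + 2)) (fv k A μ ν 1 0 (h₁ + 1)),
      r₁.y = r₂.b ∧ r₁.b = r₂.y := by
  have hW : ∀ x : bslab k, sh x ∈ RP → x ∈ W := fun x hx => hWRW (hWR x hx)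
  have hk1 := hA.2.1
  have adm9 : ∀ (p : ℤ × ℤ × ℤ), p ∈ [((0 : ℤ), (0 : ℤ), h₁), (0, 1, h₁ - 1), (0, 2, h₁), (0, 1, h₁ + 1), (0, 0, h₁ + 2), (1, 0, h₁ - 1), (1, 1, h₁),
      (1, 0, h₁ + 1), (1, 2, h₁ + 1), (1, 1, h₁ + 2)] → Adm k (fcol A μ ν p.1 p.2.1) p.2.2 := by
    intro p hp
    simp only [List.mem_cons, List.not_mem_nil, or_false] at hp
    rcases hp with rfl | rfl | rfl | rfl | rfl | rfl | rfl | rfl | rfl | rfl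
    · exact F.adm' hA 0 0 h₁ 0 (by ring) (by omega) (by omega)
    · exact F.adm' hA 0 1 (h₁ - 1) 0 (by ring) (by omega) (by omega)
    · exact F.adm' hA 0 2 h₁ 1 (by ring) (by omega) (by omega)
    · exact F.adm' hA 0 1 (h₁ + 1) 1 (by ring) (by omega) (by omega)
    · exact F.adm' hA 0 0 (h₁ + 2) 1 (by ring) (by omega) hA2
    · exact F.adm' hA 1 0 (h₁ - 1) 0 (by ring) (by omega) (by omega)
    · exact F.adm' hA 1 1 h₁ 1 (by ring) (by omega) (by omega)
    · exact F.adm' hA 1 0 (h₁ + 1) 1 (by ring) (by omega) (by omega)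
    · exact F.adm' hA 1 2 (h₁ + 1) 2 (by ring) (by omega) (by omega)
    · exact F.adm' hA 1 1 (h₁ + 2) 2 (by ring) (by omega) hA2
  have sub : ∀ (ts : List (ℤ × ℤ × ℤ)), (∀ t ∈ ts, t ∈ [((0 : ℤ), (0 : ℤ), h₁), (0, 1, h₁ - 1), (0, 2, h₁), (0, 1, h₁ + 1), (0, 0, h₁ + 2), (1, 0, h₁ - 1),
      (1, 1, h₁), (1, 0, h₁ + 1), (1, 2, h₁ + 1), (1, 1, h₁ + 2)]) → ∀ t ∈ ts, Adm k (fcol A μ ν t.1 t.2.1) t.2.2 := fun ts h t ht => adm9 t (h t ht)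
  have hadm₁ := sub [((0 : ℤ), (0 : ℤ), h₁), (0, 1, h₁ - 1), (0, 2, h₁), (0, 1, h₁ + 1), (0, 0, h₁ + 2)] (by intro t ht; simp at ht ⊢; tauto)
  have hadm₂ := sub [((0 : ℤ), (0 : ℤ), h₁), (1, 0, h₁ - 1), (1, 1, h₁), (0, 1, h₁ + 1), (0, 0, h₁ + 2)] (by intro t ht; simp at ht ⊢; tauto)
  have hadmB₁ := sub [((1 : ℤ), (0 : ℤ), h₁ - 1), (1, 1, h₁), (1, 0, h₁ + 1)] (by intro t ht; simp at ht ⊢; tauto)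
  have hadmB₂ := sub [((0 : ℤ), (1 : ℤ), h₁ - 1), (0, 2, h₁), (1, 2, h₁ + 1), (1, 1, h₁ + 2), (1, 0, h₁ + 1)] (by intro t ht; simp at ht ⊢; tauto)
  have hE : fv k A μ ν 0 0 h₁ ≠ fv k A μ ν 0 0 (h₁ + 2) := fun e => by
    have := (F.fv_inj (i := 0) (j := 0) (h := h₁) (i' := 0) (j' := 0) (h' := h₁ + 2) (adm9 (0, 0, h₁) (by simp)) (adm9 (0, 0, h₁ + 2) (by simp)) e).2.2
    omega
  have hG₁ := F.gpath_fpath (ts := [((0 : ℤ), (0 : ℤ), h₁), (0, 1, h₁ - 1), (0, 2, h₁), (0, 1, h₁ + 1), (0, 0, h₁ + 2)]) (by simp) hadm₁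
    (by simp only [List.nodup_cons, List.mem_cons, List.not_mem_nil, Prod.mk.injEq, not_or, List.nodup_nil, and_true, or_false,
      not_false_eq_true]; omega)
    (List.IsChain.cons_cons (stp (by omega)) (List.IsChain.cons_cons (stp (by omega)) (List.IsChain.cons_cons (stp (by omega)) (List.IsChain.cons_cons (stp (by omega)) (List.IsChain.singleton _)))))
  have hG₂ := F.gpath_fpath (ts := [((0 : ℤ), (0 : ℤ), h₁), (1, 0, h₁ - 1), (1, 1, h₁), (0, 1, h₁ + 1), (0, 0, h₁ + 2)]) (by simp) hadm₂
    (by simp only [List.nodup_cons, List.mem_cons, List.not_mem_nil, Prod.mk.injEq, not_or, List.nodup_nil, and_true, or_false,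
      not_false_eq_true]; omega)
    (List.IsChain.cons_cons (stp (by omega)) (List.IsChain.cons_cons (stp (by omega)) (List.IsChain.cons_cons (stp (by omega)) (List.IsChain.cons_cons (stp (by omega)) (List.IsChain.singleton _)))))
  have hB₁ := F.gpath_fpath (ts := [((1 : ℤ), (0 : ℤ), h₁ - 1), (1, 1, h₁), (1, 0, h₁ + 1)]) (by simp) hadmB₁
    (by simp only [List.nodup_cons, List.mem_cons, List.not_mem_nil, Prod.mk.injEq, not_or, List.nodup_nil, and_true, or_false,
      not_false_eq_true]; omega)
    (List.IsChain.cons_cons (stp (by omega)) (List.IsChain.cons_cons (stp (by omega)) (List.IsChain.singleton _)))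
  have hB₂ := F.gpath_fpath (ts := [((0 : ℤ), (1 : ℤ), h₁ - 1), (0, 2, h₁), (1, 2, h₁ + 1), (1, 1, h₁ + 2), (1, 0, h₁ + 1)]) (by simp) hadmB₂
    (by simp only [List.nodup_cons, List.mem_cons, List.not_mem_nil, Prod.mk.injEq, not_or, List.nodup_nil, and_true, or_false,
      not_false_eq_true]; omega)
    (List.IsChain.cons_cons (stp (by omega)) (List.IsChain.cons_cons (stp (by omega)) (List.IsChain.cons_cons (stp (by omega)) (List.IsChain.cons_cons (stp (by omega)) (List.IsChain.singleton _)))))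
  simp only [List.head_cons, List.getLast_cons_cons, List.getLast_singleton] at hG₁ hG₂ hB₁ hB₂
  have patch : ∀ (ts : List (ℤ × ℤ × ℤ)), (∀ t ∈ ts, t ∈ [((0 : ℤ), (0 : ℤ), h₁), (0, 1, h₁ - 1), (0, 2, h₁), (0, 1, h₁ + 1), (0, 0, h₁ + 2),
      (1, 0, h₁ - 1), (1, 1, h₁), (1, 0, h₁ + 1), (1, 2, h₁ + 1), (1, 1, h₁ + 2)]) → ∀ t ∈ ts, 0 ≤ t.1 ∧ t.1 ≤ 1 ∧ 0 ≤ t.2.1 ∧ t.2.1 ≤ 2 := by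
    intro ts h t ht
    have := h t ht
    simp only [List.mem_cons, List.not_mem_nil, or_false] at this
    rcases this with rfl | rfl | rfl | rfl | rfl | rfl | rfl | rfl | rfl | rfl <;> norm_num
  obtain ⟨r₁, h1y, h1b⟩ := VRouteData.exists_ofPaths' (WR := WR) (W := W) (c := fv k A μ ν 0 0 h₁) (y := fv k A μ ν 0 1 (h₁ - 1)) hG₁ hE
    (F.fpath_mem hWR hadm₁ (patch _ (by intro t ht; simp at ht ⊢; tauto)))
    ⟨[], [fv k A μ ν 0 2 h₁, fv k A μ ν 0 1 (h₁ + 1), fv k A μ ν 0 0 (h₁ + 2)], rfl⟩ hB₁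
    (F.fpath_mem hW hadmB₁ (patch _ (by intro t ht; simp at ht ⊢; tauto)))
    (F.fv_adj (adm9 (0, 0, h₁) (by simp)) (adm9 (1, 0, h₁ - 1) (by simp)) (Or.inr ⟨rfl, Or.inl rfl⟩) (Or.inr rfl))
    (F.fpath_disjoint hadmB₁ hadm₁ (by
      intro t ht; simp only [List.mem_cons, List.not_mem_nil, or_false] at ht
      rcases ht with rfl | rfl | rfl <;> simp))
  obtain ⟨r₂, h2y, h2b⟩ := VRouteData.exists_ofPaths' (WR := WR) (W := W) (c := fv k A μ ν 0 0 h₁) (y := fv k A μ ν 1 0 (h₁ - 1)) hG₂ hE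
    (F.fpath_mem hWR hadm₂ (patch _ (by intro t ht; simp at ht ⊢; tauto)))
    ⟨[], [fv k A μ ν 1 1 h₁, fv k A μ ν 0 1 (h₁ + 1), fv k A μ ν 0 0 (h₁ + 2)], rfl⟩ hB₂
    (F.fpath_mem hW hadmB₂ (patch _ (by intro t ht; simp at ht ⊢; tauto)))
    (F.fv_adj (adm9 (0, 0, h₁) (by simp)) (adm9 (0, 1, h₁ - 1) (by simp)) (Or.inl ⟨rfl, Or.inl rfl⟩) (Or.inr rfl))
    (F.fpath_disjoint hadmB₂ hadm₂ (by
      intro t ht; simp only [List.mem_cons, List.not_mem_nil, or_false] at ht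
      rcases ht with rfl | rfl | rfl | rfl | rfl <;> simp <;> omega))
  refine ⟨r₁, r₂, ?_, ?_⟩
  · rw [h1y, h2b]
  · rw [h1b, h2y]

/-! ## §4 Height difference two, all exit heights -/

/-- **THE STACKED TEMPLATE FOR `E₂ = (a, h₁ + 2)`** (`k ≥ 3`; any admissible exit height `h'` over `s`). [cite: DuminilCopinSidoraviciusTassion2016, §2.3 (proof of Fact 2)] -/
theorem stacked_swapPair_two (hk : 3 ≤ k) {WR W : Set (bslab k)} (hWR : ∀ x : bslab k, sh x ∈ RP → x ∈ WR) (hWRW : WR ⊆ W) {h₁ h' : ℤ}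
    (hA : Adm k A h₁) (hA2 : h₁ + 2 ≤ k) (hS : Adm k (fcol A μ ν 1 0) h') :
    ∃ r₁ r₂ : VRouteData (slabGraph k) WR W (fv k A μ ν 0 0 h₁) (fv k A μ ν 0 0 (h₁ + 2)) (fv k A μ ν 1 0 h'), r₁.y = r₂.b ∧ r₁.b = r₂.y := by
  by_cases hne : h' = h₁ + 1
  · subst hne
    by_cases h3 : h₁ + 3 ≤ k
    · exact F.stacked_two_B2b hWR hWRW hA h3
    · have hk' : (3 : ℤ) ≤ k := by exact_mod_cast hk
      exact F.stacked_two_B2c hWR hWRW hA (by omega) hA2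
  · exact F.stacked_two_B1 hWR hWRW hA hA2 hS hne

end Frame

end BccClawX

end Summit.CriticalPhenomena.PercolationContinuityZ3.Theorems.Transplant

end
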